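import Summits.RiemannHypothesis.RiemannHypothesis.Theorems.GroundBartaEvenWinsBeyondArchDeflationEdgeLoc2
import Literature.Analysis.ValidatedNumerics.TaylorModelEdgePanel
import Literature.Analysis.ValidatedNumerics.TaylorModelLogEdge
import Literature.NumberTheory.LFunctions.WeilArchTailRegTM
import HarnessLib

/-!
# RiemannHypothesis / GroundBarta — rung 4 (`EvenWinsBeyondArch`, stmt-RiemannHypothesis-18807 / 18085):
# the deflated Temple L-side, XVII c′ — the EDGE panel from local tables (kernel-feasible v2)

Helper file (`--supports stmt-RiemannHypothesis-18807`), RH-free, Mathlib + landed tree files only, no facts.  Prover B,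
speedrun unit `sr-gb-rung-b` (gen 4).  On the last y-panel `k = m − 1` (`y_k = c − h`) the archimedean integrals start/end
inside t-panel `0`: `E(ρ) = ∫_0^{h−ρ} G·Δ²/t` and the panel-0 piece `∫_{h−ρ}^{2h} G·Δ¹/t` of `H` are weighted sums of the
MOVING moments `∫_0^{h−ρ} G t^j dt` (`TaylorModelEdgePanel.tmem_wmom`, `partPolyI`), the other panels of `H` as in file XVI′.
With these, `dt_residualEdgeLocTM` encloses the regular part `T` of the flagged residual (`g(y)Ψ(c−y)` replaced by
`g(y)Ψ̃♮(c−y)`, `WeilArchTailRegTM`), and `dt_residualEdgeL_split` is the log split `R♭(c−s) = −½ g(c−s) log s + T(h−s)`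
consumed by `TaylorModelLogEdge.integral_sq_logEdge_le` (whose exact moments of `q = Poly.shift g c` ARE kernel-cheap, ≈ 3 s).

References: E. Bombieri, Rend. Mat. Acc. Lincei (9) 11 (2000) Thm 2 [Bombieri2000Weil]; K. Makino, M. Berz (2003).

(Part 3 of 4 of this topic; see part 1 for the overview.)
-/

set_option linter.dupNamespace false

noncomputable section

open MeasureTheory Set Filter intervalIntegral
open scoped Topology BigOperators

namespace Summit.RiemannHypothesis.RiemannHypothesis.Theorems.EvenWinsBeyondArch

open Literature.NumberTheory.LFunctions
open Literature.Analysis.ValidatedNumerics Literature.Analysis.ValidatedNumerics.PolyMP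
  Literature.Analysis.ValidatedNumerics.NumericsMP Literature.Analysis.ValidatedNumerics.ExpPoly

section EdgeArch

variable {S : ℕ} {c : ℚ} {m Dl : ℕ} {g : ℝ → ℝ}

/-- A chunk of rows of the panel-0 piece of H (kernel object). -/
def dt_archH0Chunk (S : ℕ) (c : ℚ) (m Dl : ℕ) (A0 : IPoly) (W0 : IPoly) (pw0 : Poly) (b0 n : ℕ) : IPoly :=
  wmomRangeTM S (c / (2 * m)) Dl A0 dt_kappaH (fun j ↦ dt_movMomTM S (c / (2 * m)) W0 pw0 j) b0 n

/-- A chunk of full contraction panels `i₀ ≤ i < i₀ + n` of H on the edge panel (kernel object). -/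
def dt_contrFoldTM (S : ℕ) (m : ℕ) (Gy : IPoly) (tab : ℤ → IPoly × ℤ × ℤ) (mu : ℕ → List MI) (i0 n : ℕ) : IPoly :=
  (List.range n).foldl (fun acc j ↦
    taddI acc (tsubI (tsmulI S ((mu (i0 + j)).getD 0 default) Gy)
      (widen0 (contrI S (tab (((m - 1 : ℕ) : ℤ) - (i0 + j : ℕ))).1 (mu (i0 + j)) (-1))
        ⌈(((tab (((m - 1 : ℕ) : ℤ) - (i0 + j : ℕ))).2.1 * ((mu (i0 + j)).getD 0 default).hi : ℤ) : ℚ) / S⌉))) []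

/-- The chunked H-part Taylor model: panel-0 rows in two chunks + tail, contraction panels in two chunks, far partial. -/
def dt_archHEdgeTM' (S : ℕ) (c : ℚ) (m Dl : ℕ) (A0 : IPoly) (M0 : List MI) (Gy : IPoly)
    (tab : ℤ → IPoly × ℤ × ℤ) (mu : ℕ → List MI) (W : ℕ → IPoly) (pw : ℕ → Poly) (P1 P2 F1 F2 : IPoly) (n1 n2 : ℕ) : IPoly :=
  let h : ℚ := c / (2 * m)
  let jf := 2 * m - 1
  let m0 : ℕ → MI := fun i ↦ (mu i).getD 0 default
  let far := tsubI (tmulI S h Dl Gy (partConstI S h (W jf) (pw jf) 1))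
    (widen0 (partVarI S h (tab (((m - 1 : ℕ) : ℤ) - jf)).1 (pw jf) (-1) 1)
      ⌈((((tab (((m - 1 : ℕ) : ℤ) - jf)).2.1 * (m0 jf).hi : ℤ) : ℚ) +
        2 * h * ((tabsI S h (tsubI (W jf) (ratPolyI S (pw jf))) * (tab (((m - 1 : ℕ) : ℤ) - jf)).2.2 : ℤ) : ℚ)) / S⌉)
  let P0full := wmomTM S h Dl A0 dt_kappaH (fun j ↦ tconst (M0.getD j default))
  let P0part := widen0 (taddI P1 P2) ⌈wmomTailQ S h A0 dt_kappaH (fun j ↦ (M0.getD j default).hi) (1 + n1 + n2) * S⌉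
  taddI (taddI (tsubI P0full P0part) (taddI F1 F2)) far

/-- **H on the edge panel, chunked** (`k = m − 1`, `m ≥ 2`): as `dt_tmem_archHEdge` with the expensive pieces supplied as
proven-equal literals. [cite: Bombieri2000Weil, Thm 2 (archimedean term)] -/
theorem dt_tmem_archHEdge' (hS : 0 < S) (hc : 0 < c) (hm : 2 ≤ m) (hg : Continuous g)
    {as0 : List ℝ} {A0 : IPoly} (has0 : PMem S as0 A0)
    (hexp0 : ∀ s, g (((PolyMP.panelCentre (c / (2 * m)) (m - 1) : ℚ) : ℝ) + s) = evalR as0 s)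
    {M0 : List MI} (hM0 : ∀ j, j < M0.length →
      MI.mem S (∫ t in (0 : ℝ)..(2 * ((c / (2 * m) : ℚ) : ℝ)), weilArchDensityG t * t ^ j) (M0.getD j default))
    (hlenM : A0.length ≤ M0.length + 1)
    {W0 : IPoly} (hW0 : TMem S (c / (2 * m)) (fun u ↦ weilArchDensityG (((PolyMP.panelCentre (c / (2 * m)) 0 : ℚ) : ℝ) + u)) W0)
    (pw0 : Poly)
    {Gy : IPoly} (hGy : TMem S (c / (2 * m)) (fun s ↦ g (((PolyMP.panelCentre (c / (2 * m)) (m - 1) : ℚ) : ℝ) + s)) Gy)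
    {tab : ℤ → IPoly × ℤ × ℤ}
    (htab : ∀ n : ℤ, -(m : ℤ) ≤ n → n ≤ m →
      TabOK S (2 * (c / (2 * m))) (fun s ↦ g (2 * (n : ℝ) * ((c / (2 * m) : ℚ) : ℝ) + s)) (tab n).1 (tab n).2.1 (tab n).2.2)
    (htabl : ∀ n : ℤ, -(m : ℤ) ≤ n → n ≤ m → (tab n).1.length = Dl + 1)
    {W : ℕ → IPoly} (hW : ∀ i, 1 ≤ i → i < 2 * m →
      TMem S (c / (2 * m)) (fun u ↦ weilArchDensity (((PolyMP.panelCentre (c / (2 * m)) i : ℚ) : ℝ) + u)) (W i))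
    (pw : ℕ → Poly) {mu : ℕ → List MI}
    (hmu : ∀ i, 1 ≤ i → i < 2 * m → ∀ b, b < Dl + 1 →
      MI.mem S (∫ u in (-((c / (2 * m) : ℚ) : ℝ))..((c / (2 * m) : ℚ) : ℝ),
        weilArchDensity (((PolyMP.panelCentre (c / (2 * m)) i : ℚ) : ℝ) + u) * u ^ b) ((mu i).getD b default))
    {n1 n2 : ℕ} (hn : 1 + n1 + n2 ≤ A0.length) {P1 P2 : IPoly}
    (hP1 : dt_archH0Chunk S c m Dl A0 W0 pw0 1 n1 = P1) (hP2 : dt_archH0Chunk S c m Dl A0 W0 pw0 (1 + n1) n2 = P2)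
    {nf1 nf2 : ℕ} (hnf : 1 + nf1 + nf2 = 2 * m - 1) {F1 F2 : IPoly}
    (hF1 : dt_contrFoldTM S m Gy tab mu 1 nf1 = F1) (hF2 : dt_contrFoldTM S m Gy tab mu (1 + nf1) nf2 = F2) :
    TMem S (c / (2 * m)) (fun ρ ↦ ∫ t in Ioc ((c : ℝ) - ((((PolyMP.panelCentre (c / (2 * m)) (m - 1) : ℚ) : ℝ) + ρ)))
        ((c : ℝ) + ((((PolyMP.panelCentre (c / (2 * m)) (m - 1) : ℚ) : ℝ) + ρ))),
        weilArchDensityG t * ((g (((PolyMP.panelCentre (c / (2 * m)) (m - 1) : ℚ) : ℝ) + ρ) -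
          g (((PolyMP.panelCentre (c / (2 * m)) (m - 1) : ℚ) : ℝ) + ρ - t)) / t))
      (dt_archHEdgeTM' S c m Dl A0 M0 Gy tab mu W pw P1 P2 F1 F2 n1 n2) := by
  set h : ℚ := c / (2 * m) with hh
  have hm0 : 0 < m := by omega
  have hmq : (0 : ℚ) < m := by exact_mod_cast hm0
  have hhr : (0 : ℝ) < h := dt_h_pos hc hm0
  have hh0 : (0 : ℚ) ≤ h := by rw [hh]; positivity
  set k := m - 1 with hk
  have hkm : k < m := by omega
  set y0 : ℝ := ((PolyMP.panelCentre h k : ℚ) : ℝ) with hy0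
  set tI : ℕ → ℝ := fun i ↦ ((PolyMP.panelCentre h i : ℚ) : ℝ) with htI
  set jf := 2 * m - 1 with hjf
  have hjf1 : 1 ≤ jf := by omega
  have hjf2 : jf < 2 * m := by omega
  have hjfk : jf = m + k := by omega
  set K : ℕ → ℝ → ℝ := fun i u ↦ weilArchDensity (tI i + u) with hK
  set m0r : ℕ → ℝ := fun i ↦ ∫ u in (-(h : ℝ))..h, K i u with hm0r
  have hmom0 : ∀ i, 1 ≤ i → i < 2 * m → MI.mem S (m0r i) ((mu i).getD 0 default) := by
    intro i hi1 hi2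
    have := hmu i hi1 hi2 0 (by omega)
    simpa [hm0r, hK] using this
  set F : ℝ → ℝ → ℝ := fun ρ t ↦ weilArchDensityG t * ((g (y0 + ρ) - g (y0 + ρ - t)) / t) with hF
  have hFint : ∀ ρ (a b : ℝ), 0 ≤ a → a ≤ b → IntervalIntegrable (F ρ) volume a b := by
    intro ρ a b ha hab
    have hpoly : Continuous fun t : ℝ ↦
        ∑ p ∈ Finset.range as0.length, ∑ b ∈ Finset.range (as0.length - p),
          ρ ^ p * (as0.getD (p + b) 0 * ((p + b).choose p : ℝ)) *
            (if b = 0 then 0 else (-1 : ℝ) ^ (b + 1) * t ^ (b - 1)) := by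
      refine continuous_finsetSum _ fun p _ ↦ continuous_finsetSum _ fun b _ ↦ ?_
      by_cases hb : b = 0
      · simp only [hb, if_true, mul_zero]; exact continuous_const
      · simp only [hb, if_false]; exact continuous_const.mul (continuous_const.mul (continuous_pow _))
    refine (intervalIntegrable_weilArchDensityG_mul ha hab hpoly).congr fun t ht ↦ ?_
    have ht0 : 0 < t := by rw [Set.uIoc_of_le hab] at ht; exact lt_of_le_of_lt ha ht.1
    simp only [hF]
    rw [firstDiff_div_eq_sum hexp0 ρ ht0.ne']
  have hFpanel : ∀ i, 1 ≤ i → ∀ ρ u, -(h : ℝ) ≤ u →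
      F ρ (tI i + u) = K i u * (g (y0 + ρ) - g ((y0 - tI i) + (ρ + (-1 : ℤ) * u))) := by
    intro i hi ρ u hu
    have e1 : y0 + ρ - (tI i + u) = (y0 - tI i) + (ρ + ((-1 : ℤ) : ℝ) * u) := by push_cast; ring
    simp only [hF, hK]
    rw [dt_G_mul_div (t := tI i + u) (dt_tI_add_pos hc hm0 hi hu), e1]
  have htabM : ∀ i, 1 ≤ i → i ≤ m + k →
      TabOK S (2 * h) (fun s ↦ g ((y0 - tI i) + s)) (tab ((k : ℤ) - i)).1 (tab ((k : ℤ) - i)).2.1 (tab ((k : ℤ) - i)).2.2 ∧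
      (tab ((k : ℤ) - i)).1.length = Dl + 1 := by
    intro i hi1 hi2
    have hn1 : -(m : ℤ) ≤ (k : ℤ) - i := by omega
    have hn2 : (k : ℤ) - i ≤ m := by omega
    have e : (fun s ↦ g (2 * (((k : ℤ) - i : ℤ) : ℝ) * (h : ℝ) + s)) = fun s ↦ g ((y0 - tI i) + s) := by
      funext s; rw [dt_base_minus]
    have := htab _ hn1 hn2
    rw [e] at this
    exact ⟨this, htabl _ hn1 hn2⟩
  have hKi : ∀ i, 1 ≤ i → IntervalIntegrable (K i) volume (-(h : ℝ)) h := fun i hi ↦ dt_intervalIntegrable_K hc hm0 hi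
  have hK0 : ∀ i, 1 ≤ i → ∀ u ∈ Icc (-(h : ℝ)) h, 0 ≤ K i u := fun i hi ↦ dt_K_nonneg hc hm0 hi
  have hmu' : ∀ i, 1 ≤ i → i < 2 * m → ∀ (L : ℕ), L = Dl + 1 → ∀ b, b < L →
      MI.mem S (∫ u in (-(h : ℝ))..h, K i u * u ^ b) ((mu i).getD b default) := by
    intro i hi1 hi2 L hL b hb; subst hL; exact hmu i hi1 hi2 b hb
  have hgc : ∀ b0 : ℝ, Continuous fun s ↦ g (b0 + s) := fun b0 ↦ hg.comp (continuous_const.add continuous_id)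
  -- (a) panel-0 pieces
  have hP0full : TMem S h (fun ρ ↦ ∫ t in (0 : ℝ)..(2 * (h : ℝ)), F ρ t)
      (wmomTM S h Dl A0 dt_kappaH (fun j ↦ tconst (M0.getD j default))) := by
    refine tmem_wmom hS hh0 Dl has0 (by simp [dt_kappaH])
      (fun j hj ↦ tmem_const (S := S) (h := h) (hM0 j (by omega))) fun ρ _ ↦ ?_
    rw [← has0.length_eq]
    exact dt_integral_firstDiff_expand hexp0 ρ (by positivity)
  have hP0part : TMem S h (fun ρ ↦ ∫ t in (0 : ℝ)..((h : ℝ) - ρ), F ρ t)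
      (widen0 (taddI P1 P2) ⌈wmomTailQ S h A0 dt_kappaH (fun j ↦ (M0.getD j default).hi) (1 + n1 + n2) * S⌉) := by
    subst hP1 hP2
    refine tmem_wmom_chunks hS hh0 has0 (by simp [dt_kappaH]) hn
      (tmem_wmomRange hS hh0 Dl has0 dt_kappaH 1 n1 fun j _ ↦ dt_tmem_movMom hS hc hm0 hW0 pw0 _)
      (tmem_wmomRange hS hh0 Dl has0 dt_kappaH (1 + n1) n2 fun j _ ↦ dt_tmem_movMom hS hc hm0 hW0 pw0 _)
      (fun ρ hρ ↦ dt_movMom_bounds hS hc hm0 hM0 hlenM hρ) fun ρ hρ ↦ ?_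
    rw [← has0.length_eq]
    exact dt_integral_firstDiff_expand hexp0 ρ (by linarith [(abs_le.1 hρ).2])
  -- (b) full panels `1 ≤ i < jf`
  have hfull : ∀ i, i < jf → 1 ≤ i → TMem S h (fun ρ ↦ ∫ u in (-(h : ℝ))..h, F ρ (tI i + u))
      (tsubI (tsmulI S ((mu i).getD 0 default) Gy)
        (widen0 (contrI S (tab ((k : ℤ) - i)).1 (mu i) (-1))
          ⌈(((tab ((k : ℤ) - i)).2.1 * ((mu i).getD 0 default).hi : ℤ) : ℚ) / S⌉)) := by
    intro i hij hi1
    have hi2 : i < 2 * m := by omega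
    obtain ⟨hTm, hLm⟩ := htabM i hi1 (by omega)
    have T1 := tmem_smulI hS (hmom0 i hi1 hi2) hGy
    have T2 := tmem_contrI hS hh0 le_rfl hTm (hgc _) (hKi i hi1) (hK0 i hi1) (hmu' i hi1 hi2 _ hLm)
      (by omega) (sgn := -1) (Or.inr rfl)
    refine tmem_congr_on (tmem_sub T1 T2) fun ρ hρ ↦ ?_
    have hcongr : ∫ u in (-(h : ℝ))..h, F ρ (tI i + u) = ∫ u in (-(h : ℝ))..h,
        K i u * (g (y0 + ρ) - g ((y0 - tI i) + (ρ + (-1 : ℤ) * u))) :=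
      intervalIntegral.integral_congr fun u hu ↦ hFpanel i hi1 ρ u (by
        rw [Set.uIcc_of_le (by linarith)] at hu; exact hu.1)
    rw [hcongr]
    have hI1 : IntervalIntegrable (fun u ↦ K i u * g (y0 + ρ)) volume (-(h : ℝ)) h := (hKi i hi1).mul_const _
    have hI2 : IntervalIntegrable (fun u ↦ K i u * g ((y0 - tI i) + (ρ + (-1 : ℤ) * u))) volume (-(h : ℝ)) h :=
      intervalIntegrable_kernel_mul (hKi i hi1) ((hgc _).comp (by fun_prop))
    have esplit : ∫ u in (-(h : ℝ))..h, K i u * (g (y0 + ρ) - g ((y0 - tI i) + (ρ + (-1 : ℤ) * u))) =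
        (∫ u in (-(h : ℝ))..h, K i u * g (y0 + ρ)) - ∫ u in (-(h : ℝ))..h, K i u * g ((y0 - tI i) + (ρ + (-1 : ℤ) * u)) := by
      rw [← intervalIntegral.integral_sub hI1 hI2]
      exact intervalIntegral.integral_congr fun u _ ↦ by ring
    rw [esplit, intervalIntegral.integral_mul_const]
  have hch : ∀ i0 n, 1 ≤ i0 → i0 + n ≤ jf →
      TMem S h (fun ρ ↦ ∑ j ∈ Finset.range n, ∫ u in (-(h : ℝ))..h, F ρ (tI (i0 + j) + u))
        (dt_contrFoldTM S m Gy tab mu i0 n) := by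
    intro i0 n hi0 hin
    induction n with
    | zero => simpa [dt_contrFoldTM] using tmem_zero' S h
    | succ n ih =>
        have ih' := ih (by omega)
        unfold dt_contrFoldTM at ih' ⊢
        rw [List.range_succ, List.foldl_append, List.foldl_cons, List.foldl_nil]
        refine tmem_congr_on (tmem_add ih' (hfull (i0 + n) (by omega) (by omega))) fun ρ _ ↦ ?_
        rw [Finset.sum_range_succ]
  have hfold : TMem S h (fun ρ ↦ (0 : ℝ) + ∑ i ∈ (Finset.range jf).filter (fun i ↦ 1 ≤ i),
      ∫ u in (-(h : ℝ))..h, F ρ (tI i + u)) (taddI F1 F2) := by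
    subst hF1 hF2
    refine tmem_congr_on (tmem_add (hch 1 nf1 le_rfl (by omega)) (hch (1 + nf1) nf2 (by omega) (by omega))) fun ρ _ ↦ ?_
    rw [zero_add]
    have eIco : (Finset.range jf).filter (fun i ↦ 1 ≤ i) = Finset.Ico 1 jf := by
      ext i; simp only [Finset.mem_Ico, Finset.mem_filter, Finset.mem_range]; omega
    rw [eIco, show jf = 1 + nf1 + nf2 by omega, ← Finset.sum_Ico_consecutive _ (by omega : 1 ≤ 1 + nf1) (by omega : 1 + nf1 ≤ 1 + nf1 + nf2),
      Finset.sum_Ico_eq_sum_range, Finset.sum_Ico_eq_sum_range]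
    congr 1
    · rw [show 1 + nf1 - 1 = nf1 by omega]
    · rw [show 1 + nf1 + nf2 - (1 + nf1) = nf2 by omega]
  -- (c) far partial at `jf` (`τ = 1`)
  obtain ⟨hTm, hLm⟩ := htabM jf hjf1 (by omega)
  have hWj := hW jf hjf1 hjf2
  have hpc : TMem S h (fun ρ ↦ ∫ u in (-(h : ℝ))..(((1 : ℤ) : ℝ) * ρ), K jf u) (partConstI S h (W jf) (pw jf) 1) :=
    tmem_partConst hS hh0 (hKi jf hjf1) hWj (pw jf) (Or.inl rfl)
  have T1 := tmem_mul hS hh0 Dl hGy hpc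
  have T2 := tmem_partVar hS hh0 le_rfl hTm (hgc _) (hKi jf hjf1) (hK0 jf hjf1) hWj (pw jf) (hmom0 jf hjf1 hjf2)
    (sgn := -1) (τ := 1) (Or.inr rfl) (Or.inl rfl)
  have hfar := tmem_congr_on (f' := fun ρ ↦ ∫ u in (-(h : ℝ))..ρ, F ρ (tI jf + u)) (tmem_sub T1 T2) fun ρ hρ ↦ by
    have hρ1 := (abs_le.1 hρ).1
    have hρ2 := (abs_le.1 hρ).2
    have e1 : (((1 : ℤ) : ℝ) * ρ) = ρ := by push_cast; ring
    rw [e1]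
    have hcongr : ∫ u in (-(h : ℝ))..ρ, F ρ (tI jf + u) = ∫ u in (-(h : ℝ))..ρ,
        K jf u * (g (y0 + ρ) - g ((y0 - tI jf) + (ρ + (-1 : ℤ) * u))) :=
      intervalIntegral.integral_congr fun u hu ↦ hFpanel jf hjf1 ρ u (by
        rw [Set.uIcc_of_le (by linarith)] at hu; exact hu.1)
    rw [hcongr]
    have hKsub : IntervalIntegrable (K jf) volume (-(h : ℝ)) ρ :=
      (hKi jf hjf1).mono_set (by rw [Set.uIcc_of_le (by linarith), Set.uIcc_of_le (by linarith)];
                                 exact Icc_subset_Icc le_rfl hρ2)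
    have hI1 : IntervalIntegrable (fun u ↦ K jf u * g (y0 + ρ)) volume (-(h : ℝ)) ρ := hKsub.mul_const _
    have hI2 : IntervalIntegrable (fun u ↦ K jf u * g ((y0 - tI jf) + (ρ + (-1 : ℤ) * u))) volume (-(h : ℝ)) ρ :=
      hKsub.mul_continuousOn ((hgc _).comp (by fun_prop)).continuousOn
    have esplit : ∫ u in (-(h : ℝ))..ρ, K jf u * (g (y0 + ρ) - g ((y0 - tI jf) + (ρ + (-1 : ℤ) * u))) =
        (∫ u in (-(h : ℝ))..ρ, K jf u * g (y0 + ρ)) - ∫ u in (-(h : ℝ))..ρ, K jf u * g ((y0 - tI jf) + (ρ + (-1 : ℤ) * u)) := by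
      rw [← intervalIntegral.integral_sub hI1 hI2]
      exact intervalIntegral.integral_congr fun u _ ↦ by ring
    rw [esplit, intervalIntegral.integral_mul_const]
    ring
  -- (d) assemble
  refine tmem_congr_on (tmem_add (tmem_add (tmem_sub hP0full hP0part) hfold) hfar) fun ρ hρ ↦ ?_
  have hρ1 := (abs_le.1 hρ).1
  have hρ2 := (abs_le.1 hρ).2
  have hcy : (c : ℝ) - y0 = h := by
    rw [hy0]; have := dt_c_sub_y0 (c := c) (k := k) hkm
    rw [show m - 1 - k = 0 by omega] at this
    rw [this, dt_tI_eq, hh]; push_cast; ring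
  have hTn : (c : ℝ) - (y0 + ρ) = (h : ℝ) - ρ := by rw [← hcy]; ring
  have hTf : (c : ℝ) + (y0 + ρ) = tI jf + ρ := by
    simp only [hy0, htI]; rw [hjfk, ← dt_c_add_y0 (c := c) (k := k) hm0]; ring
  have htIjf : tI jf = (2 * jf + 1) * (h : ℝ) := by simp only [htI]; rw [dt_tI_eq]
  have hjfr : (2 : ℝ) ≤ jf := by exact_mod_cast (by omega : 2 ≤ jf)
  have h2h : (0 : ℝ) ≤ 2 * h := by positivity
  have hA : (0 : ℝ) ≤ (h : ℝ) - ρ := by linarith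
  have hB : (h : ℝ) - ρ ≤ 2 * h := by linarith
  have hC : 2 * (h : ℝ) ≤ 2 * jf * h := by nlinarith
  have hD : 2 * jf * (h : ℝ) ≤ tI jf + ρ := by rw [htIjf]; nlinarith
  rw [hTn, hTf, ← intervalIntegral.integral_of_le ((hB.trans hC).trans hD)]
  have I1 := hFint ρ 0 ((h : ℝ) - ρ) le_rfl hA
  have I2 := hFint ρ ((h : ℝ) - ρ) (2 * h) hA hB
  have I3 := hFint ρ (2 * h) (2 * jf * h) h2h hC
  have I4 := hFint ρ (2 * jf * h) (tI jf + ρ) (h2h.trans hC) hD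
  rw [← intervalIntegral.integral_add_adjacent_intervals (I2.trans I3) I4,
    ← intervalIntegral.integral_add_adjacent_intervals I2 I3]
  have e02 : ∫ t in ((h : ℝ) - ρ)..(2 * (h : ℝ)), F ρ t =
      (∫ t in (0 : ℝ)..(2 * (h : ℝ)), F ρ t) - ∫ t in (0 : ℝ)..((h : ℝ) - ρ), F ρ t := by
    rw [← intervalIntegral.integral_add_adjacent_intervals I1 I2]; ring
  have emid : ∫ t in (2 * (h : ℝ))..(2 * jf * (h : ℝ)), F ρ t =
      (∫ t in (0 : ℝ)..(2 * jf * (h : ℝ)), F ρ t) - ∫ t in (0 : ℝ)..(2 * (h : ℝ)), F ρ t := by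
    rw [← intervalIntegral.integral_add_adjacent_intervals (I1.trans I2) I3]; ring
  rw [e02, emid, intervalIntegral_eq_sum_panels (F ρ) hhr.le (fun a b ha hab ↦ hFint ρ a b ha hab) jf]
  have e1p : ∫ t in (0 : ℝ)..(2 * (h : ℝ)), F ρ t = ∫ t in (0 : ℝ)..(2 * (1 : ℕ) * (h : ℝ)), F ρ t := by norm_num
  rw [e1p, intervalIntegral_eq_sum_panels (F ρ) hhr.le (fun a b ha hab ↦ hFint ρ a b ha hab) 1,
    ← Finset.sum_Ico_eq_sub _ hjf1]
  have eIco : Finset.Ico 1 jf = (Finset.range jf).filter (fun i ↦ 1 ≤ i) := by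
    ext i; simp only [Finset.mem_Ico, Finset.mem_filter, Finset.mem_range]; omega
  rw [eIco]
  have emid' : ∑ i ∈ (Finset.range jf).filter (fun i ↦ 1 ≤ i), ∫ u in (-(h : ℝ))..h, F ρ ((2 * (i : ℝ) + 1) * h + u) =
      ∑ i ∈ (Finset.range jf).filter (fun i ↦ 1 ≤ i), ∫ u in (-(h : ℝ))..h, F ρ (tI i + u) := by
    refine Finset.sum_congr rfl fun i _ ↦ ?_
    simp only [htI]; rw [dt_tI_eq]
  have efar : ∫ t in (2 * jf * (h : ℝ))..(tI jf + ρ), F ρ t = ∫ u in (-(h : ℝ))..ρ, F ρ (tI jf + u) := by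
    have := intervalIntegral.integral_comp_add_right (F ρ) (tI jf) (a := -(h : ℝ)) (b := ρ)
    rw [show -(h : ℝ) + tI jf = 2 * jf * h by rw [htIjf]; ring, show ρ + tI jf = tI jf + ρ by ring] at this
    rw [← this]
    exact intervalIntegral.integral_congr fun u _ ↦ by rw [add_comm]
  rw [emid', efar]
  ring

end EdgeArch

end Summit.RiemannHypothesis.RiemannHypothesis.Theorems.EvenWinsBeyondArch

end
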